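import Summits.ABC.IUTFork.Joshi.LogVolumesHullsLocalField
import Literature.IUT.LogVolume.TensorPacketVolume

/-!
# D-05 at the level of a TENSOR PACKET: Joshi's (9.10.3.1) weighted volume of a ball-tuple vs Mochizuki's
# [IUTchIV] Prop. 1.4 log-volume of the set `(⊗_i h_i)·(R_I)^∼ ⊂ ⊗_{ℚ_p} k_i` — and the tuple/tensor well-definedness

K. Joshi, *Construction of Arithmetic Teichmüller Spaces III* (arXiv:2401.13508 **v4**, unrefereed; bib
`Joshi2024ATS3`), §9.10.3 (9.10.3.1) p.124 l.8–11 («it suffices to define Vol^Γ(V_1 ⊗_{ℤ_p} … ⊗_{ℤ_p} V_n) = Vol^{γ_1}(V_1)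
··· Vol^{γ_n}(V_n)»), §9.10.5 (9.10.5.1) p.125 l.9–15. Cell abc-iut, block E (rung LADDER-ABC:A2.E), seat E-t23 (slot T-23;
OBJECTS O-045, dictionary row D-05). Joshi's side = the typed §9.10 objects with each factor the local-field datum of
`LogVolumesHullsLocalField` (p432005: `Vol_{k_i}` = [AbsTopIII] 5.7 (i) `μ`, `|−|_{k_i}` = the module `‖−‖^{d_i}`);
Mochizuki's side = the tree's campaign-S typing of [IUTchIV] Prop. 1.4 (i) on the tensor packet `V = ⊗_{ℚ_p} k_i`
(`Literature.IUT.LogVolume.packetLogVolume`: Haar measure on `⊕_j L_j` normalised on `∏ 𝒪_{L_j} = ψ((R_I)^∼)`, log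
divided by the degree `D`). RESULTS (PROVED, numbers — no verdict):
(A) `log_weightedVol_balls`: Joshi's `log Vol^Γ((h_i𝒪_{k_i})_i) = Σ_i γ_i·d_i·log‖h_i‖`.
(B) `log_weightedVol_eq_mul_packetLogVolume`: whenever `γ_i·d_i = c` for all factors, Joshi's value is `c ×` Mochizuki's
`μ^log((⊗h_i)·(R_I)^∼) = Σ_i log‖h_i‖` (campaign-S `packetLogVolume_ppow_mul_purePacket_smul`) — with Joshi's `Γ_p`
(`γ_i = 1/[k_i : L_{mod,v_i}]`, `gammaP_mul_degree`) `c = [L_{mod,v} : ℚ_p]` at a fixed place `w` (all factors `L′_{w,j} ≅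
L′_w`). (C) WELL-DEFINEDNESS LOCATION (`purePacket_update_natCast`, `weightedVol_update_eq`): in `V` the pure tensors of
`(p, 1, …, 1)` and `(1, p, 1, …)` COINCIDE (multilinearity: `p` moves across `⊗_{ℤ_p}`), so the SETS `(ph_1𝒪)⊗h_2𝒪⊗…` and
`h_1𝒪⊗(ph_2𝒪)⊗…` are equal, while Joshi's tuple recipe assigns them `log`-volumes differing by `(γ_2d_2 − γ_1d_1)·log p`:
(9.10.3.1) descends from ball-TUPLES to subsets of the tensor product iff `γ_i·d_i` is constant across the factors —
satisfied in Joshi's use at a fixed `w` (L2 of SUMMARY-T23), recorded here as a kernel fact about the typed recipe.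
FRAMING: bookkeeping over two typed vocabularies; nothing of Joshi's or Mochizuki's disputed material is asserted; no side
taken on [IUTchIII] Cor. 3.12 or on any author.
-/

noncomputable section

namespace Summit.ABC.IUTFork.Joshi.LogVol

open MeasureTheory Metric Literature.IUT.LogVolume Literature.NumberTheory.GaloisRepresentations.Ultrametric
open scoped Pointwise

variable (p : ℕ) [Fact p.Prime]
variable {I : Type} [Fintype I] [DecidableEq I]
variable (k : I → Type) [∀ i, NontriviallyNormedField (k i)] [∀ i, NormedAlgebra ℚ_[p] (k i)]
  [∀ i, IsUltrametricDist (k i)] [∀ i, ProperSpace (k i)] [∀ i, MeasurableSpace (k i)] [∀ i, BorelSpace (k i)]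

/-- **Joshi's factor data on a tensor packet**: per factor `k_i` a norm uniformizer `ϖ_i`, the degree `d_i = [k_i : ℚ_p]`
and the classical relation `‖ϖ_i‖^{d_i} = q_i⁻¹` (from the MLF files). SIGNATURE. [folklore] -/
structure FactorData where
  /-- uniformizers -/ ϖ : ∀ i, (k i)ˣ
  /-- … are norm uniformizers -/ hϖ : ∀ i, IsUniformizer (ϖ i)
  /-- degrees `d_i = [k_i : ℚ_p]` -/ d : I → ℕ
  /-- `d_i ≠ 0` -/ hd : ∀ i, d i ≠ 0
  /-- `‖ϖ_i‖^{d_i} = q_i⁻¹` -/ hmod : ∀ i, ‖(ϖ i : k i)‖ ^ d i = ((residueCard (k i) : ℝ))⁻¹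

variable {p k}

/-- The §9.10.2 volume data of the factors (p432005 `localFieldVolumeDatum`, module absolute values). [folklore] -/
def FactorData.volumeData (F : FactorData k) : ∀ i, VolumeDatum (k i) :=
  fun i => localFieldVolumeDatum (k i) (F.hϖ i) (F.hd i) (F.hmod i)

omit [DecidableEq I] in
/-- **(A)** Joshi's Γ-weighted log-volume (9.10.3.1) of the ball-tuple `(h_i𝒪_{k_i})_i` is `Σ_i γ_i·d_i·log‖h_i‖`. PROVED.
[claim: Joshi2024ATS3, status: disputed] -/
theorem log_weightedVol_balls (F : FactorData k) (Γ : Weights I) (h : Π i, k i) (hh : ∀ i, h i ≠ 0) :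
    Real.log (weightedVol F.volumeData Γ fun i => (F.volumeData i).ball 0 (h i))
      = ∑ i, Γ.γ i * (F.d i) * Real.log ‖h i‖ := by
  have hvol : ∀ i, ((F.volumeData i).vol ((F.volumeData i).ball 0 (h i))).toReal = ‖h i‖ ^ F.d i := fun i => by
    rw [(F.volumeData i).vol_ball 0 (hh i), ENNReal.toReal_ofReal ((F.volumeData i).abs.nonneg _)]
    rfl
  have hpos : ∀ i, 0 < ((F.volumeData i).vol ((F.volumeData i).ball 0 (h i))).toReal := fun i => by
    rw [hvol i]; exact pow_pos (norm_pos_iff.2 (hh i)) _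
  rw [log_weightedVol_eq_packetLogVolume F.volumeData Γ _ hpos]
  unfold Literature.IUT.LogThetaLattice.packetLogVolume
  refine Finset.sum_congr rfl fun i _ => ?_
  rw [hvol i, Real.log_pow]
  ring

variable {J : Type} [Fintype J] (L : J → Type) [∀ j, NontriviallyNormedField (L j)] [∀ j, NormedAlgebra ℚ_[p] (L j)]
  [∀ j, IsUltrametricDist (L j)] [∀ j, ProperSpace (L j)] [∀ j, MeasurableSpace (L j)] [∀ j, BorelSpace (L j)]
  (ψ : PacketAlgebra p k ≃ₐ[ℚ_[p]] (Π j, L j))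

/-- **(B) D-05 AT PACKET LEVEL, PROVED**: if `γ_i·d_i = c` for every factor, Joshi's Γ-weighted log-volume of the ball-tuple
`(h_i𝒪_{k_i})_i` equals `c` times Mochizuki's [IUTchIV] Prop. 1.4 (i) degree-normalised log-volume of the set
`(⊗_i h_i)·(R_I)^∼ ⊂ ⊗_{ℚ_p} k_i` (campaign-S `packetLogVolume`, `= Σ_i log‖h_i‖`). With Joshi's `Γ_p` at a fixed place,
`c = [L_{mod,v} : ℚ_p]`. [claim: Joshi2024ATS3, status: disputed] -/
theorem log_weightedVol_eq_mul_packetLogVolume [Nonempty I] [Nonempty J] (F : FactorData k) (Γ : Weights I)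
    (c : ℝ) (hc : ∀ i, Γ.γ i * (F.d i) = c) (h : Π i, k i) (hh : ∀ i, h i ≠ 0) :
    Real.log (weightedVol F.volumeData Γ fun i => (F.volumeData i).ball 0 (h i))
      = c * packetLogVolume p k L ψ
          ((ppow p k 0 * purePacket p k h) • (normalizedPacket p k : Set (PacketAlgebra p k))) := by
  rw [log_weightedVol_balls F Γ h hh, packetLogVolume_ppow_mul_purePacket_smul p k L ψ 0 h hh]
  simp only [Int.cast_zero, zero_mul, neg_zero, zero_add, Finset.mul_sum]
  exact Finset.sum_congr rfl fun i _ => by rw [hc i]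

/-! ## (C) Tuple vs tensor: `p` moves across the tensor sign -/

omit [Fintype I] [∀ i, IsUltrametricDist (k i)] [∀ i, ProperSpace (k i)] [∀ i, MeasurableSpace (k i)]
  [∀ i, BorelSpace (k i)] in
/-- In `V = ⊗_{ℚ_p} k_i` the pure tensor of the family `(1, …, p, …, 1)` (`p` at position `i`) does not depend on `i`: it is
`p·(1 ⊗ ⋯ ⊗ 1)` (multilinearity). PROVED. [folklore] -/
theorem purePacket_update_natCast (i : I) :
    purePacket p k (Function.update (1 : Π i', k i') i (p : k i)) = (p : ℚ_[p]) • purePacket p k (1 : Π i', k i') := by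
  have e : (p : k i) = (p : ℚ_[p]) • (1 : k i) := by
    rw [Algebra.smul_def, mul_one, map_natCast]
  unfold purePacket
  rw [e, MultilinearMap.map_update_smul,
    show Function.update (1 : Π i', k i') i (1 : k i) = 1 from Function.update_eq_self_iff.2 rfl]

omit [Fintype I] [∀ i, IsUltrametricDist (k i)] [∀ i, ProperSpace (k i)] [∀ i, MeasurableSpace (k i)]
  [∀ i, BorelSpace (k i)] in
/-- Hence the SETS `(⊗(1,…,p_i,…,1))·(R_I)^∼` for different positions `i` of the factor `p` coincide. PROVED. [folklore] -/
theorem smul_normalizedPacket_update_eq (i j : I) :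
    purePacket p k (Function.update (1 : Π i', k i') i (p : k i)) • (normalizedPacket p k : Set (PacketAlgebra p k))
      = purePacket p k (Function.update (1 : Π i', k i') j (p : k j)) •
          (normalizedPacket p k : Set (PacketAlgebra p k)) := by
  rw [purePacket_update_natCast, purePacket_update_natCast]

/-- … whereas Joshi's tuple recipe (9.10.3.1) assigns to the ball-tuple with `p` in factor `i` the `log`-volume
`−γ_i·d_i·log p`: PROVED. So (9.10.3.1) descends from tuples to subsets of the tensor product iff `γ_i·d_i` does not depend
on `i` (LOCATION L2; satisfied at a fixed place `w`, all factors `≅ L′_w`). [claim: Joshi2024ATS3, status: disputed] -/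
theorem log_weightedVol_update (F : FactorData k) (Γ : Weights I) (i : I) :
    Real.log (weightedVol F.volumeData Γ fun i' =>
        (F.volumeData i').ball 0 (Function.update (1 : Π i', k i') i (p : k i) i'))
      = -(Γ.γ i * (F.d i) * Real.log p) := by
  have hne : ∀ i', Function.update (1 : Π i', k i') i (p : k i) i' ≠ 0 := fun i' => by
    rcases eq_or_ne i' i with rfl | hne
    · rw [Function.update_self]; exact prime_ne_zero p (k _)
    · rw [Function.update_of_ne hne]; exact one_ne_zero
  rw [log_weightedVol_balls F Γ _ hne, ← Finset.add_sum_erase _ _ (Finset.mem_univ i), Function.update_self,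
    norm_prime p (k i), Real.log_inv, Finset.sum_eq_zero]
  · ring
  · intro i' hi'
    rw [Function.update_of_ne (Finset.ne_of_mem_erase hi'), Pi.one_apply, norm_one, Real.log_one, mul_zero]

/-- **(C) in one line**: equal SETS, tuple log-volumes differing by `(γ_j d_j − γ_i d_i)·log p`. PROVED.
[claim: Joshi2024ATS3, status: disputed] -/
theorem log_weightedVol_update_sub (F : FactorData k) (Γ : Weights I) (i j : I) :
    Real.log (weightedVol F.volumeData Γ fun i' =>
          (F.volumeData i').ball 0 (Function.update (1 : Π i', k i') i (p : k i) i'))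
        - Real.log (weightedVol F.volumeData Γ fun i' =>
          (F.volumeData i').ball 0 (Function.update (1 : Π i', k i') j (p : k j) i'))
      = (Γ.γ j * (F.d j) - Γ.γ i * (F.d i)) * Real.log p := by
  rw [log_weightedVol_update, log_weightedVol_update]; ring

end Summit.ABC.IUTFork.Joshi.LogVol

end
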